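import Summits.SmoothPoincare4.SmoothPoincare4.Theorems.SymplecticOrigamiFoldedSphereFoldExistenceFoldMapSphere
import Summits.SmoothPoincare4.SmoothPoincare4.Theorems.SymplecticOrigamiFoldedSphereFoldExistenceSphere
import Summits.SmoothPoincare4.Statement
import Literature.Topology.FourManifolds.HomotopyS4FoldMap
import Literature.Topology.FourManifolds.ConnectedSumTransportProofs

/-!
# The named fact `eliashberg_foldMap_homotopySphere_four` follows from `SmoothPoincare4`

Sanity / zero-slack bookkeeping for item `stmt-SmoothPoincare4-14076` (`FoldedSphereFoldExistence`,
rung 0 of route SymplecticOrigami). The item is closed MODULO the named fact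
`Literature.Topology.FourManifolds.eliashberg_foldMap_homotopySphere_four` (Eliashberg's
equidimensional folding theorem, instance: a fold map `M → ℝ⁴` along a chart 3-sphere on every
smooth homotopy 4-sphere; `foldedSphereFoldExistence_of_eliashbergFoldMap`). This file certifies
that the fact is not stronger than the summit: its conclusion is invariant under diffeomorphism
(`exists_foldMap_of_diffeomorph`, transporting the round datum `eliashberg_foldMap_sphere` — the
linear projection `S⁴ ⊂ ℝ⁵ → ℝ⁴` folding along the equator — along any `S⁴ ≃ₘ M`), hence
`SmoothPoincare4 → eliashberg_foldMap_homotopySphere_four`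
(`eliashberg_foldMap_homotopySphere_four_of_smoothPoincare4`). Together with
`foldedSphereFoldExistence_of_smoothPoincare4` (the item from SPC4) and
`foldedSphereFoldExistence_of_eliashbergFoldMap` (the item from the fact) this records:
SPC4 ⇒ fact ⇒ item, so neither the fact nor the item can be refuted short of refuting SPC4.
-/

noncomputable section

-- the prescribed namespace `Summit.<P>.<Sub>.…` duplicates `SmoothPoincare4` (P = Sub)
set_option linter.dupNamespace false

open scoped Manifold ContDiff Topology
open Set Function Metric

namespace Summit.SmoothPoincare4.SmoothPoincare4.Theorems.FoldedSphereFoldExistence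

/-- **Transport of a fold-map datum along a diffeomorphism.** If `Ψ : S⁴ ≃ₘ M`, then `M` carries
the datum of `eliashberg_foldMap_homotopySphere_four`: with `(e, f)` the round datum on `S⁴`
(`eliashberg_foldMap_sphere`), take `e' = Ψ ∘ e`, `f' = f ∘ Ψ⁻¹`, and transport the fold charts
`φ` of `S⁴` to the charts `φ ∘ Ψ⁻¹` of the maximal atlas of `M`
(`Literature.Topology.FourManifolds.exists_transportChart`); the target charts `ψ` of `ℝ⁴` are
kept. [folklore] -/
theorem exists_foldMap_of_diffeomorph {M : Type*} [TopologicalSpace M]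
    [ChartedSpace (EuclideanSpace ℝ (Fin 4)) M] [IsManifold (𝓡 4) ∞ M]
    (Ψ : (sphere (0 : EuclideanSpace ℝ (Fin 5)) 1) ≃ₘ⟮𝓡 4, 𝓡 4⟯ M) :
    ∃ (e : EuclideanSpace ℝ (Fin 4) → M) (f : M → EuclideanSpace ℝ (Fin 4)),
      ContMDiff (𝓡 4) (𝓡 4) ∞ e ∧ Topology.IsEmbedding e ∧
      (∀ y, Function.Injective (mfderiv (𝓡 4) (𝓡 4) e y)) ∧
      ContMDiff (𝓡 4) (𝓡 4) ∞ f ∧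
      (∀ x, x ∉ Set.range (fun n : Metric.sphere (0 : EuclideanSpace ℝ (Fin 4)) 1 => e n) →
        Function.Injective (mfderiv (𝓡 4) (𝓡 4) f x)) ∧
      (∀ n : Metric.sphere (0 : EuclideanSpace ℝ (Fin 4)) 1,
        ∃ (φ : OpenPartialHomeomorph M (EuclideanSpace ℝ (Fin 4)))
          (ψ : OpenPartialHomeomorph (EuclideanSpace ℝ (Fin 4)) (EuclideanSpace ℝ (Fin 4))),
          e n ∈ φ.source ∧ φ ∈ IsManifold.maximalAtlas (𝓡 4) ∞ M ∧
          ψ ∈ IsManifold.maximalAtlas (𝓡 4) ∞ (EuclideanSpace ℝ (Fin 4)) ∧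
          φ.source ⊆ f ⁻¹' ψ.source ∧
          (∀ x ∈ φ.source, ψ (f x) = φ x + ((φ x 0) ^ 2 - φ x 0) •
            EuclideanSpace.single (0 : Fin 4) (1 : ℝ)) ∧
          (∀ x ∈ φ.source,
            x ∈ Set.range (fun n : Metric.sphere (0 : EuclideanSpace ℝ (Fin 4)) 1 => e n) ↔
              φ x 0 = 0)) := by
  obtain ⟨e, f, he, hemb, hde, hf, hreg, hfold⟩ := eliashberg_foldMap_sphere
  have h1 : (1 : WithTop ℕ∞) ≠ 0 := one_ne_zero
  have hΨd : ∀ y, MDifferentiableAt (𝓡 4) (𝓡 4) Ψ y := fun y =>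
    Ψ.contMDiff.mdifferentiableAt (by simp)
  have hΨsd : ∀ x, MDifferentiableAt (𝓡 4) (𝓡 4) Ψ.symm x := fun x =>
    Ψ.symm.contMDiff.mdifferentiableAt (by simp)
  -- the differential of `Ψ` and of `Ψ.symm` is injective (two-sided inverse)
  have hΨinj : ∀ y, Injective (mfderiv (𝓡 4) (𝓡 4) Ψ y) := fun y =>
    mfderiv_injective_of_leftInverse (π := Ψ.symm) (funext Ψ.symm_apply_apply) (hΨd y)
      (hΨsd _)
  have hΨsinj : ∀ x, Injective (mfderiv (𝓡 4) (𝓡 4) Ψ.symm x) := fun x =>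
    mfderiv_injective_of_leftInverse (π := Ψ) (funext Ψ.apply_symm_apply) (hΨsd x) (hΨd _)
  -- the range of the transported chart sphere
  have hrange : ∀ x : M,
      x ∈ Set.range (fun n : Metric.sphere (0 : EuclideanSpace ℝ (Fin 4)) 1 => (Ψ ∘ e) n) ↔
        Ψ.symm x ∈ Set.range (fun n : Metric.sphere (0 : EuclideanSpace ℝ (Fin 4)) 1 => e n) := by
    intro x
    constructor
    · rintro ⟨n, rfl⟩
      exact ⟨n, by simp⟩
    · rintro ⟨n, hn⟩
      exact ⟨n, by simp [Function.comp_apply, hn]⟩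
  refine ⟨Ψ ∘ e, f ∘ Ψ.symm, Ψ.contMDiff.comp he, ?_, ?_, hf.comp Ψ.symm.contMDiff, ?_, ?_⟩
  · -- topological embedding
    exact Ψ.toHomeomorph.isEmbedding.comp hemb
  · -- injective differential of `Ψ ∘ e`
    intro y
    rw [mfderiv_comp y (hΨd (e y)) (he.mdifferentiableAt (by simp))]
    exact (hΨinj (e y)).comp (hde y)
  · -- regular off the transported chart sphere
    intro x hx
    have hx' : Ψ.symm x ∉
        Set.range (fun n : Metric.sphere (0 : EuclideanSpace ℝ (Fin 4)) 1 => e n) :=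
      fun h => hx ((hrange x).2 h)
    rw [mfderiv_comp x (hf.mdifferentiableAt (by simp)) (hΨsd x)]
    exact (hreg _ hx').comp (hΨsinj x)
  · -- fold charts, transported along `Ψ`
    intro n
    obtain ⟨φ, ψ, hmem, hφ, hψ, hsrc, hnf, hZ⟩ := hfold n
    obtain ⟨χ, hχ, hχsrc, hχx⟩ :=
      Literature.Topology.FourManifolds.exists_transportChart (IP := 𝓡 4) (IP' := 𝓡 4)
        (HP' := EuclideanSpace ℝ (Fin 4)) Ψ rfl hφ
    have hχx' : ∀ x, χ x = φ (Ψ.symm x) := fun x => by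
      rw [hχx]
      simp
    refine ⟨χ, ψ, ?_, hχ, hψ, ?_, ?_, ?_⟩
    · rw [hχsrc]
      simpa using hmem
    · intro x hx
      rw [hχsrc] at hx
      exact hsrc hx
    · intro x hx
      rw [hχsrc] at hx
      rw [hχx' x]
      exact hnf _ hx
    · intro x hx
      rw [hχsrc] at hx
      rw [hχx' x, hrange x]
      exact hZ _ hx

/-- **`SmoothPoincare4 → eliashberg_foldMap_homotopySphere_four`**: if every smooth homotopy
4-sphere is diffeomorphic to `S⁴`, the named fact holds by transport of the round fold map
(`exists_foldMap_of_diffeomorph`). So the one unproved premise of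
`foldedSphereFoldExistence_of_eliashbergFoldMap` is implied by the summit statement (zero-slack
certificate for the debt). [folklore] -/
theorem eliashberg_foldMap_homotopySphere_four_of_smoothPoincare4 (hS : _root_.SmoothPoincare4) :
    Literature.Topology.FourManifolds.eliashberg_foldMap_homotopySphere_four := by
  intro M _ _ _ _ _ hM
  have hS' := hS
  unfold _root_.SmoothPoincare4 Literature.SPC4.SmoothPoincareConjectureFour
    ContinuousMap.HomotopyEquiv.NonemptyDiffeomorphSphere at hS'
  obtain ⟨Φ⟩ := hS' M inferInstance inferInstance hM
  exact exists_foldMap_of_diffeomorph Φ.symm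

end Summit.SmoothPoincare4.SmoothPoincare4.Theorems.FoldedSphereFoldExistence

end
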